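import Summits.BirchSwinnertonDyer.BirchSwinnertonDyer.Theses.ErratumRoadFive
import Summits.BirchSwinnertonDyer.BirchSwinnertonDyer.Theorems.ErratumRoadFiveJSWSigmaLocalCharIdeal
import Summits.BirchSwinnertonDyer.BirchSwinnertonDyer.Theorems.ErratumRoadFiveIMCDivRoadFFSigmaDataBOfFacts
import Summits.BirchSwinnertonDyer.BirchSwinnertonDyer.Theorems.ErratumRoadFiveKernelFromPrintBOfFacts
import Summits.BirchSwinnertonDyer.BirchSwinnertonDyer.Theorems.ErratumRoadFiveIMCDivRoadFFFittingFrameBOfThm23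
import HarnessLib
-- (buildfix 2026-08-28) explicit import: the route file's 03:58Z re-render no longer brings this module transitively
import Summits.BirchSwinnertonDyer.BirchSwinnertonDyer.Theorems.ErratumRoadFiveIMCDivRoadFFFittingFrameBOfMembers

/-!
# Route `ErratumRoadFive` (rung K2, `p ≥ 5`): the crux `IMCDivAtErratumDataAllR` (item 20169), the parent `OpenInputIMC` (item 19061)
# and the K2 leaf `X11b.MultiplicativeRankOne` BY NAME from the route's items WITHOUT support item 19626
# `JSWAnticyclotomicControlMult` (cell `bsd-stepL`, seat `bsd-stepL-imc-p1` g16; `--supports stmt-BirchSwinnertonDyer-19626 --as helper`)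

This module imports the route file (its hypotheses and conclusions ARE route decls, by name), so no `_holds` link can be stated here.

## What this file proves

The Jetchev–Skinner–Wan control fact (JSW17 Thm. 3.3.1 at a multiplicative `p`, the route's support item 19626, binder `h331` of
`closes`) is used by the route's deciding theorem only through (a) the torsion of `X^∅_ac` at erratum fields (Road FF, `have h3`)
and (b) `X11b.P2ControlOnTreeAt` on the (ram) ∧ erratum locus (kernel «19061-body from print», `have h₁`). Both are now supplied by
the tree's kernel control theorem `X11b.controlOnTreeAt_of_mult_of_rankOne_odd` (image-free, torsion-robust; Brink Thm. 2, Milne I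
Thm. 2.8, `cd_p ≤ 2` discharged in-kernel) modulo GZK, modularity and the two Poitou–Tate facts — conjuncts 2, 4, 13, 14 of the
route's OWN support item 19283 `PublishedInputsIMCReduction` (`Theorems/ErratumRoadFiveControlOfFacts.lean`,
`…IMCDivRoadFFSigmaDataBOfFacts.lean`, `…KernelFromPrintBOfFacts.lean`, this seat). Hence, BY NAME:

* §1 `imcDivAtErratumDataAllR_of_memberPackage_of_items_noJSW` — **20169 ⟸ 20529 + 19283** (was `+ 19626`, g15
  `imcDivAtErratumDataAllR_of_memberPackage_of_items`); and the F-split twin `imcDivAtErratumDataAllR_of_thm23_OPEN_of_frames_of_items_noJSW`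
  — 20169 ⟸ F4♯ + F3♯ + 19283 (was `+ 19626`).
* §2 `openInputIMC_of_memberPackage_of_rest3_of_notRam_noJSW` — **19061 ⟸ 20529 + 19625 + 19283 + 19285 + 19624 + 19282** (six items,
  was seven); and the F-split twin `openInputIMC_of_thm23_OPEN_of_frames_of_rest3_of_notRam_noJSW`.
* §3 `multiplicativeRankOne_of_items_without_jsw` — the route's `closes` VERBATIM with the binder `h331` deleted (fifteen items ⟹ the K2
  leaf), i.e. the kernel certificate that 19626 can leave the deciding theorem with no new hypothesis.
* §4 `multiplicativeRankOne_of_thm23_items_without_jsw` — the same on plan g38's staged F-split glue (PROPOSAL (γ), `plan/SWAPF/`): the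
  two edits commute.

HONEST FRAMING: theorems only (no definition, no named fact, no `sorry`); CONDITIONAL on the route's items as hypotheses (the member
package 20529 ∕ F4♯ is OPEN and unrefereed: erratum (2.4)–(2.5) via [FW21 Thm. 4.41]); item 19626 itself (the JSW fact VERBATIM) is
NOT proved here and stays citable; nothing is booked; BSD is proved for no pair; no census word, tier or label moves (T7).

References: [Castella2018Erratum] (2.4)–(2.5), Thm. 1.1, Thm. 2.3 (pp. 1–4); [FouquetWan2021] Thm. 4.41 (claim);
[JetchevSkinnerWan2017] Thm. 3.3.1 with §3.5 (3.5.c), proof of Thm. 6.1.6; [SkinnerUrban2014] Prop. 3.2.3; [Castella2018Exceptional]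
Thms. 2.10–2.11; [Wuthrich2014] Prop. 21; [MilneADT2006] I Thm. 4.10, Thm. 2.8; [Brink2007] Thm. 2.
-/

set_option autoImplicit false
-- the Theorems namespace of this sub repeats the summit name by design (D-0017 nested layout)
set_option linter.dupNamespace false

noncomputable section

open scoped Classical
open WeierstrassCurve NumberField IsDedekindDomain
open Literature.NumberTheory.EllipticCurves Literature.NumberTheory.EllipticCurves.ModularForms
  Literature.NumberTheory.EllipticCurves.Rank1Residual Literature.NumberTheory.EllipticCurves.JetchevSkinnerWan2017
  Literature.NumberTheory.EllipticCurves.Castella2018 Literature.NumberTheory.GaloisCohomology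
open Summit.BirchSwinnertonDyer.Rank1Residual.X11b
open Summit.BirchSwinnertonDyer.BirchSwinnertonDyer.Theses.ErratumRoadFive

namespace Summit.BirchSwinnertonDyer.BirchSwinnertonDyer.Theorems

/-! ### §1 Crux 20169 without 19626 -/

/-- **Crux 20169 `IMCDivAtErratumDataAllR` BY NAME from crux 20529 `CastellaErratumMemberPackage` (OPEN) + GZK + modularity + the two
Poitou–Tate facts — NO Jetchev–Skinner–Wan fact** (the local `Σ`-atom and Shapiro are THEOREMS of the tree; the torsion of `X^∅_ac`
comes from the kernel control theorem). CONDITIONAL on the named inputs (one OPEN, unrefereed); nothing booked.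
[claim: Castella2018Erratum, status: under-review] [claim: FouquetWan2021, status: under-review]
[cite: Castella2018Erratum, (2.4)–(2.5) and proof of Thm. 1.1 (pp. 3–4)]
[cite: JetchevSkinnerWan2017, Thm. 3.3.1 with §3.5 (3.5.c); proof of Thm. 6.1.6 (local display)] [cite: MilneADT2006, Ch. I, Thm. 4.10] -/
theorem imcDivAtErratumDataAllR_of_memberPackage_noJSW (hMem : CastellaErratumMemberPackage)
    (hGZK : rank_eq_analyticRank_of_analyticRank_le_one) (hnf : exists_isNewformOf)
    (hPT : ∀ (K : Type) [Field K] [NumberField K], poitouTate_selmerStructure_duality K)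
    (hPT2 : ∀ (K : Type) [Field K] [NumberField K], poitouTate_sha_tateDual K) : IMCDivAtErratumDataAllR :=
  fun W _ _ p _ ↦
    P2.imcDivIntCoreFrameAtErratumDataB_of_roadFF_fitting
      (P2.RoadFF.sigmaDataAtErratumDataB_of_sigmaLocal_of_prop323_of_facts W p
        sigmaLocal_charIdeal_eulerFactor_mem_of_noTamagawaDefect_proved
        SkinnerUrban2014.prop323_XAc_equiv_XBigDecomp_holds hGZK hnf hPT hPT2)
      (P2.RoadFF.fittingCongruenceFrameAtErratumDataB_of_members_of_prop323 hMem
        SkinnerUrban2014.prop323_XAc_equiv_XBigDecomp_holds W p)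

/-- **Crux 20169 BY NAME from TWO ITEMS of the route: `20169 ⟸ 20529 + 19283`** (GZK, modularity and the two Poitou–Tate facts =
conjuncts 2, 4, 13, 14 of support 19283 `PublishedInputsIMCReduction`; support 19626 no longer needed). CONDITIONAL; nothing booked.
[claim: Castella2018Erratum, status: under-review] [claim: FouquetWan2021, status: under-review]
[cite: Castella2018Erratum, (2.4)–(2.5) and proof of Thm. 1.1 (pp. 3–4)] [cite: JetchevSkinnerWan2017, Thm. 3.3.1] -/
theorem imcDivAtErratumDataAllR_of_memberPackage_of_items_noJSW (hMem : CastellaErratumMemberPackage)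
    (hF : PublishedInputsIMCReduction) : IMCDivAtErratumDataAllR :=
  imcDivAtErratumDataAllR_of_memberPackage_noJSW hMem hF.2.1 hF.2.2.2.1 hF.2.2.2.2.2.2.2.2.2.2.2.2.1
    hF.2.2.2.2.2.2.2.2.2.2.2.2.2.1

/-- **Crux 20169 BY NAME from F4♯ (erratum Thm. 2.3 «⊂», OPEN) + F3♯ (Hida-member frames, PUB) + GZK + modularity + the two Poitou–Tate
facts — NO Jetchev–Skinner–Wan fact** (g15's `imcDivAtErratumDataAllR_of_thm23_OPEN_of_frames` with `h331 ↦ hPT, hPT2`). CONDITIONAL;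
nothing booked. [claim: Castella2018Erratum, status: under-review] [claim: FouquetWan2021, status: under-review]
[cite: Castella2018Erratum, Thm. 2.3 and (2.4)–(2.5) (pp. 3–4)] [cite: JetchevSkinnerWan2017, Thm. 3.3.1 with §3.5 (3.5.c)] -/
theorem imcDivAtErratumDataAllR_of_thm23_OPEN_of_frames_noJSW (h23 : erratumThm23_charIdeal_sigma_le_of_isTorsion_OPEN)
    (hL : erratum_exists_frames_members_sigma_congruence)
    (hGZK : rank_eq_analyticRank_of_analyticRank_le_one) (hnf : exists_isNewformOf)
    (hPT : ∀ (K : Type) [Field K] [NumberField K], poitouTate_selmerStructure_duality K)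
    (hPT2 : ∀ (K : Type) [Field K] [NumberField K], poitouTate_sha_tateDual K) : IMCDivAtErratumDataAllR :=
  fun W _ _ p _ ↦
    P2.imcDivIntCoreFrameAtErratumDataB_of_roadFF_fitting
      (P2.RoadFF.sigmaDataAtErratumDataB_of_sigmaLocal_of_prop323_of_facts W p
        sigmaLocal_charIdeal_eulerFactor_mem_of_noTamagawaDefect_proved
        SkinnerUrban2014.prop323_XAc_equiv_XBigDecomp_holds hGZK hnf hPT hPT2)
      (P2.RoadFF.fittingCongruenceFrameAtErratumDataB_of_thm23_OPEN_of_frames h23 hL W p)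

/-- **Crux 20169 BY NAME from F4♯ + F3♯ + ONE ITEM (19283)** (was `+ 19626`). CONDITIONAL; nothing booked.
[claim: Castella2018Erratum, status: under-review] [claim: FouquetWan2021, status: under-review]
[cite: Castella2018Erratum, Thm. 2.3 and (2.4)–(2.5) (pp. 3–4)] [cite: JetchevSkinnerWan2017, Thm. 3.3.1] -/
theorem imcDivAtErratumDataAllR_of_thm23_OPEN_of_frames_of_items_noJSW
    (h23 : erratumThm23_charIdeal_sigma_le_of_isTorsion_OPEN) (hL : erratum_exists_frames_members_sigma_congruence)
    (hF : PublishedInputsIMCReduction) : IMCDivAtErratumDataAllR :=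
  imcDivAtErratumDataAllR_of_thm23_OPEN_of_frames_noJSW h23 hL hF.2.1 hF.2.2.2.1 hF.2.2.2.2.2.2.2.2.2.2.2.2.1
    hF.2.2.2.2.2.2.2.2.2.2.2.2.2.1

/-! ### §2 The parent 19061 without 19626 -/

/-- **The parent 19061 `OpenInputIMC` BY NAME from SIX ITEMS of the route: `19061 ⟸ 20529 + 19625 + 19283 + 19285 + 19624 + 19282`**
(was seven, with 19626) — composition of §1 with `KernelFromPrintB.openInputIMCBody_of_print_of_coreB_of_rest3_of_notRam_of_facts`.
CONDITIONAL; nothing booked; BSD is proved for no pair.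
[claim: Castella2018Erratum, status: under-review] [claim: FouquetWan2021, status: under-review]
[cite: Castella2018Erratum, Thm. 1.1 and proof (pp. 1–4)] [cite: Castella2018Exceptional, Thms. 2.10–2.11]
[cite: Wuthrich2014, Prop. 21] [cite: JetchevSkinnerWan2017, Thm. 3.3.1 with §3.5 (3.5.c)] -/
theorem openInputIMC_of_memberPackage_of_rest3_of_notRam_noJSW (hMem : CastellaErratumMemberPackage)
    (hVN : BDPValueContinuityInput) (hF : PublishedInputsIMCReduction) (hWu : WuthrichShaDividesAnalyticSha)
    (hrest : RamNoErratumDataAtFive) (hOff : OpenInputNotRam) : OpenInputIMC := by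
  intro W _ _ p _
  exact KernelFromPrintB.openInputIMCBody_of_print_of_coreB_of_rest3_of_notRam_of_facts hVN
    (imcDivAtErratumDataAllR_of_memberPackage_of_items_noJSW hMem hF) hF hWu hrest hOff W p

/-- **The parent 19061 BY NAME from F4♯ + F3♯ + FIVE ITEMS** (19625, 19283, 19285, 19624, 19282; was six, with 19626). CONDITIONAL;
nothing booked; BSD is proved for no pair. [claim: Castella2018Erratum, status: under-review] [claim: FouquetWan2021, status: under-review]
[cite: Castella2018Erratum, Thm. 1.1, Thm. 2.3 and proof (pp. 1–4)] [cite: Castella2018Exceptional, Thms. 2.10–2.11]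
[cite: Wuthrich2014, Prop. 21] [cite: JetchevSkinnerWan2017, Thm. 3.3.1 with §3.5 (3.5.c)] -/
theorem openInputIMC_of_thm23_OPEN_of_frames_of_rest3_of_notRam_noJSW
    (h23 : erratumThm23_charIdeal_sigma_le_of_isTorsion_OPEN) (hL : erratum_exists_frames_members_sigma_congruence)
    (hVN : BDPValueContinuityInput) (hF : PublishedInputsIMCReduction) (hWu : WuthrichShaDividesAnalyticSha)
    (hrest : RamNoErratumDataAtFive) (hOff : OpenInputNotRam) : OpenInputIMC := by
  intro W _ _ p _
  exact KernelFromPrintB.openInputIMCBody_of_print_of_coreB_of_rest3_of_notRam_of_facts hVN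
    (imcDivAtErratumDataAllR_of_thm23_OPEN_of_frames_of_items_noJSW h23 hL hF) hF hWu hrest hOff W p

/-! ### §3 The K2 leaf from the route's items without 19626 (`closes` minus the binder `h331`) -/

/-- **THE K2 LEAF FROM THE ROUTE'S ITEMS WITHOUT 19626** — `Theses.ErratumRoadFive.closes` (rev 40) VERBATIM with the binder
`h331 : JSWAnticyclotomicControlMult` DELETED: the `have h3` line uses
`P2.RoadFF.sigmaDataAtErratumDataB_of_sigmaLocal_of_prop323_of_facts` (conjuncts 2, 4, 13, 14 of `hF`) and the `have h₁` line
`KernelFromPrintB.openInputIMCBody_of_print_of_coreB_of_rest3_of_notRam_of_facts`; every other line byte-identical. This is the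
kernel certificate that support item 19626 can leave the deciding theorem with NO new hypothesis (a planner `--closes-file` = this
body). CONDITIONAL on the remaining fifteen items (one OPEN crux among them); nothing booked; BSD is proved for no pair; no tier,
census word or label moves (T7). [claim: Castella2018Erratum, status: under-review] [claim: FouquetWan2021, status: under-review]
[cite: JetchevSkinnerWan2017, Thm. 3.3.1 with §3.5 (3.5.c) (arXiv:1512.06894 pp. 11, 15)] [cite: MilneADT2006, Ch. I, Thm. 4.10 and Thm. 2.8] -/
theorem multiplicativeRankOne_of_items_without_jsw (hMem : CastellaErratumMemberPackage) (hloc : JSWSigmaLocalCharIdeal)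
    (hrest : RamNoErratumDataAtFive) (hOff : OpenInputNotRam)
    (hF : PublishedInputsIMCReduction) (hWu : WuthrichShaDividesAnalyticSha)
    (hVN : BDPValueContinuityInput)
    (hRes : EulerHalfNotRamNoInertSetAtFive) (h₃ : X11aLowerHalf) (h₄ : NonSurjCorner)
    (h₅ : PublishedInputsFive) (hJL : ShimuraParametrizationDataNonempty) (hCO : PastenComponentOrdersInput)
    (hCTi : ShimuraCasselsTateLevelInputs) (hESi : ShimuraHeegnerEulerSystemInertPrintedR) :
    Summit.BirchSwinnertonDyer.Rank1Residual.X11b.MultiplicativeRankOne := by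
  show Summit.BirchSwinnertonDyer.Rank1Residual.X11b.MultiplicativeRankOne
  have h3 : IMCDivAtErratumDataAllR := fun W _ _ p _ ↦
    Summit.BirchSwinnertonDyer.Rank1Residual.X11b.P2.imcDivIntCoreFrameAtErratumDataB_of_roadFF_fitting
      (Summit.BirchSwinnertonDyer.Rank1Residual.X11b.P2.RoadFF.sigmaDataAtErratumDataB_of_sigmaLocal_of_prop323_of_facts
        W p hloc Literature.NumberTheory.EllipticCurves.SkinnerUrban2014.prop323_XAc_equiv_XBigDecomp_holds
        hF.2.1 hF.2.2.2.1 hF.2.2.2.2.2.2.2.2.2.2.2.2.1 hF.2.2.2.2.2.2.2.2.2.2.2.2.2.1)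
      (Summit.BirchSwinnertonDyer.Rank1Residual.X11b.P2.RoadFF.fittingCongruenceFrameAtErratumDataB_of_members_of_prop323
        hMem Literature.NumberTheory.EllipticCurves.SkinnerUrban2014.prop323_XAc_equiv_XBigDecomp_holds W p)
  obtain ⟨hGZ, hKo, hB, hSk, hWu', hGZK, hmod, hnf, hHL, hFHs, hMaz, hBDMTV, hFH, hPT, hEP⟩ := h₅
  have hESg : Literature.NumberTheory.EllipticCurves.shimuraCurve_heegnerSystem_primitivesGuarded :=
    Summit.BirchSwinnertonDyer.BirchSwinnertonDyer.Theorems.primitivesGuarded_of_GZK_of_entire_of_primitivesFromFive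
      hGZK hmod hESi
  have hKOi : ShimuraKolyvaginOrderBoundInertFromFive := by
    refine Summit.BirchSwinnertonDyer.BirchSwinnertonDyer.Theorems.shimuraKolyvaginOrderBoundInert_of_shimuraLabelsGuarded_of_casselsTate_of_poitouTate
      hPT ?_ hESg
    intro K _ _ W _ p M₀ hp hp2 hM₀ _ c hc hcc e hμ hadd₁ hadd₂ hgal halt hnd
    obtain ⟨inv, hPT', hH3, hperf, hB', hPτ⟩ := hCTi K W p M₀ hp hp2 hM₀ c hc hcc e hμ hadd₁ hadd₂ hgal halt hnd
    exact ⟨inv, hPT', hH3, fun v ↦ (hperf v).1.injective, hB', hPτ⟩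
  have hHKi : Literature.NumberTheory.EllipticCurves.shimuraCurve_heegnerPoint_grossZagier_kolyvagin_inert := by
    intro W _ _ p _ N _ K _ _ S Dt X W' _ P₀ hN hp5 hsurj hK hS hin hsp hpS hc hmin
    obtain ⟨-, y, degy, -, -, h0y, hvy, hLy, -⟩ := hESg W p N K S Dt X W' P₀ hN hp5 hsurj hK hS hin hsp hpS hc hmin
    exact ⟨y, degy, h0y, hvy, hLy,
      hKOi W p N K S Dt X W' P₀ hN hp5 hsurj hK hS hin hsp hpS hc hmin y degy h0y hvy hLy⟩
  have h₁ : ∀ (W : WeierstrassCurve ℚ) [W.IsElliptic] [W.IsGloballyMinimal] (p : ℕ) [Fact p.Prime],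
      Summit.BirchSwinnertonDyer.Rank1Residual.X11b.P2OpenInputOnTreeAt W p :=
    Summit.BirchSwinnertonDyer.BirchSwinnertonDyer.Theorems.KernelFromPrintB.openInputIMCBody_of_print_of_coreB_of_rest3_of_notRam_of_facts
      hVN h3 hF hWu hrest hOff
  exact Summit.BirchSwinnertonDyer.BirchSwinnertonDyer.Theorems.multiplicativeRankOne_of_endState_inert_notRamResidual
    hGZ hKo hB hSk hWu' hGZK hmod hnf hHL hFHs hMaz hBDMTV hFH hPT hEP hJL hCO hHKi h₁ hRes h₃ h₄

/-! ### §4 The same on the planner's staged F-split (plan/SWAPF, PROPOSAL (γ), director-gated): `closes_previewF` minus `h331` -/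

/-- **THE K2 LEAF FROM THE F-SPLIT ITEMS WITHOUT 19626** — plan g38's staged `closes` of PROPOSAL (γ) (`plan/SWAPF/glue-ErratumRoadFive.lean`:
`(hMem : CastellaErratumMemberPackage)` ↦ `(h23 : ErratumThm23SigmaLe) (hMF : ErratumHidaMemberFrames)`, here spelled by their Literature
names F4♯ `erratumThm23_charIdeal_sigma_le_of_isTorsion_OPEN` ∕ F3♯ `erratum_exists_frames_members_sigma_congruence` since the two decls are
not yet route items) with the binder `h331` DELETED as in §3. Certifies that the two edits (E-free open input; drop 19626) COMMUTE. CONDITIONAL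
(F4♯ OPEN, claim-tagged); nothing booked; BSD is proved for no pair; no tier, census word or label moves (T7).
[claim: Castella2018Erratum, status: under-review] [claim: FouquetWan2021, status: under-review]
[cite: Castella2018Erratum, Thm. 2.3 and (2.4)–(2.5) (pp. 3–4)] [cite: JetchevSkinnerWan2017, Thm. 3.3.1 with §3.5 (3.5.c)] -/
theorem multiplicativeRankOne_of_thm23_items_without_jsw
    (h23 : erratumThm23_charIdeal_sigma_le_of_isTorsion_OPEN) (hMF : erratum_exists_frames_members_sigma_congruence)
    (hloc : JSWSigmaLocalCharIdeal)
    (hrest : RamNoErratumDataAtFive) (hOff : OpenInputNotRam)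
    (hF : PublishedInputsIMCReduction) (hWu : WuthrichShaDividesAnalyticSha)
    (hVN : BDPValueContinuityInput)
    (hRes : EulerHalfNotRamNoInertSetAtFive) (h₃ : X11aLowerHalf) (h₄ : NonSurjCorner)
    (h₅ : PublishedInputsFive) (hJL : ShimuraParametrizationDataNonempty) (hCO : PastenComponentOrdersInput)
    (hCTi : ShimuraCasselsTateLevelInputs) (hESi : ShimuraHeegnerEulerSystemInertPrintedR) :
    Summit.BirchSwinnertonDyer.Rank1Residual.X11b.MultiplicativeRankOne := by
  show Summit.BirchSwinnertonDyer.Rank1Residual.X11b.MultiplicativeRankOne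
  have h3 : IMCDivAtErratumDataAllR := fun W _ _ p _ ↦
    Summit.BirchSwinnertonDyer.Rank1Residual.X11b.P2.imcDivIntCoreFrameAtErratumDataB_of_roadFF_fitting
      (Summit.BirchSwinnertonDyer.Rank1Residual.X11b.P2.RoadFF.sigmaDataAtErratumDataB_of_sigmaLocal_of_prop323_of_facts
        W p hloc Literature.NumberTheory.EllipticCurves.SkinnerUrban2014.prop323_XAc_equiv_XBigDecomp_holds
        hF.2.1 hF.2.2.2.1 hF.2.2.2.2.2.2.2.2.2.2.2.2.1 hF.2.2.2.2.2.2.2.2.2.2.2.2.2.1)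
      (Summit.BirchSwinnertonDyer.Rank1Residual.X11b.P2.RoadFF.fittingCongruenceFrameAtErratumDataB_of_thm23_OPEN_of_frames
        h23 hMF W p)
  obtain ⟨hGZ, hKo, hB, hSk, hWu', hGZK, hmod, hnf, hHL, hFHs, hMaz, hBDMTV, hFH, hPT, hEP⟩ := h₅
  have hESg : Literature.NumberTheory.EllipticCurves.shimuraCurve_heegnerSystem_primitivesGuarded :=
    Summit.BirchSwinnertonDyer.BirchSwinnertonDyer.Theorems.primitivesGuarded_of_GZK_of_entire_of_primitivesFromFive
      hGZK hmod hESi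
  have hKOi : ShimuraKolyvaginOrderBoundInertFromFive := by
    refine Summit.BirchSwinnertonDyer.BirchSwinnertonDyer.Theorems.shimuraKolyvaginOrderBoundInert_of_shimuraLabelsGuarded_of_casselsTate_of_poitouTate
      hPT ?_ hESg
    intro K _ _ W _ p M₀ hp hp2 hM₀ _ c hc hcc e hμ hadd₁ hadd₂ hgal halt hnd
    obtain ⟨inv, hPT', hH3, hperf, hB', hPτ⟩ := hCTi K W p M₀ hp hp2 hM₀ c hc hcc e hμ hadd₁ hadd₂ hgal halt hnd
    exact ⟨inv, hPT', hH3, fun v ↦ (hperf v).1.injective, hB', hPτ⟩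
  have hHKi : Literature.NumberTheory.EllipticCurves.shimuraCurve_heegnerPoint_grossZagier_kolyvagin_inert := by
    intro W _ _ p _ N _ K _ _ S Dt X W' _ P₀ hN hp5 hsurj hK hS hin hsp hpS hc hmin
    obtain ⟨-, y, degy, -, -, h0y, hvy, hLy, -⟩ := hESg W p N K S Dt X W' P₀ hN hp5 hsurj hK hS hin hsp hpS hc hmin
    exact ⟨y, degy, h0y, hvy, hLy,
      hKOi W p N K S Dt X W' P₀ hN hp5 hsurj hK hS hin hsp hpS hc hmin y degy h0y hvy hLy⟩
  have h₁ : ∀ (W : WeierstrassCurve ℚ) [W.IsElliptic] [W.IsGloballyMinimal] (p : ℕ) [Fact p.Prime],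
      Summit.BirchSwinnertonDyer.Rank1Residual.X11b.P2OpenInputOnTreeAt W p :=
    Summit.BirchSwinnertonDyer.BirchSwinnertonDyer.Theorems.KernelFromPrintB.openInputIMCBody_of_print_of_coreB_of_rest3_of_notRam_of_facts
      hVN h3 hF hWu hrest hOff
  exact Summit.BirchSwinnertonDyer.BirchSwinnertonDyer.Theorems.multiplicativeRankOne_of_endState_inert_notRamResidual
    hGZ hKo hB hSk hWu' hGZK hmod hnf hHL hFHs hMaz hBDMTV hFH hPT hEP hJL hCO hHKi h₁ hRes h₃ h₄

end Summit.BirchSwinnertonDyer.BirchSwinnertonDyer.Theorems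

end
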